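/-
Copyright: the b2b-balaban T⁴-continuum CRUX team, row NE7b OWNER lineage `t4-ne7b-p1` (gen 137). Project licence.
-/
import Summits.QuantumFields.BalabanUV.T4Continuum.Spine.NE7b.SupBlockStepLineDerivatives

/-!
# THE TILTED HESSIAN NUMERATOR OF A `C³` BLOCK INPUT IS DIFFERENTIABLE IN THE BACKGROUND — the class-closure plan, item (c), first half
# ((402) one order up).  For a `C³` block potential `U` (`HasFDerivAt U″ (U‴ φ) φ`, `U‴` continuous) with the four block letters (stability
# `κ₀` on `Y`, gradient `κ₁, a`, `‖U″‖ ≤ κ₂`, `‖U‴‖ ≤ κ₃`), over `N(0,Γ)` with `Γ ⪯ γ_op·1` and the regulator margin `(2κ₀(1+τ)+4δ)γ_op ≤ θ < 1`: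
# (i) the PRODUCT RULE at the trilinear level: `ψ ↦ e^{−U(ω+ψ)}•(U″(ω+ψ) − U′(ω+ψ)⊗U′(ω+ψ))` has derivative
#     `Φ(ω,ψ) = e^{−U}•(U‴ − (U′⊗·)∘U″ − ((⊗)∘U″)ᵀU′) + (e^{−U}•(−U′))⊗(U″ − U′⊗U′)`   (all at `ω+ψ`; `⊗ = smulRight`),
# (ii) THE THIRD BLOCK DOMINATION in operator norm: `‖Φ(ω,ψ)‖ ≤ e^{−U}(‖U′‖³ + 3κ₂‖U′‖ + κ₃) ≤ K₃(ψ₁)·e^{½(2κ₀(1+τ)+4δ)Σ_Yω²}` for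
#     `‖ψ − ψ₁‖ ≤ 1` ((405)'s third domination), and
# (iii) DOMINATED DIFFERENTIATION: `HasFDerivAt (ψ ↦ ∫e^{−U}•(U″ − U′⊗U′)dN(0,Γ)) (∫Φ(ω,ψ₀)dN(0,Γ)) ψ₀` at EVERY `ψ₀`
# — the input of the third Fréchet derivative of `W = −log Z` (successor file) (row NE7b, node U5c; (399)∕(402)∕(403)∕(405) BY NAME; [folklore])

Cell `pub-balaban`, sub-cell `t4`, spine estimate NE7b (`T4WeightBudget.RelWeightBound`; the cell's OWN estimate — NOT PRINTED in
[Bałaban 1983–89], NOT PROVED).  Crux-route work under `Spine/NE7b/` by the row OWNER (`t4-ne7b-p1` gen 137, file (418)) under FREEZE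
(0)'s crux-prover clause (this gen's class-closure audit, item (c): the output must be Fréchet-`C³` as the input is); NOTHING of Bałaban's is
named as a Lean object, valued or asserted; no `T4Continuum/Support` leaf typed; no `def`, no notation (`Φ` WRITTEN OUT); zero `sorry`.
Imports (BY NAME): the OWNER's (405) `…SupBlockStepLineDerivatives` (`block_third_domination`) and through it (403)
(`integrable_weightedBlockHess`), (313) (`integrable_domination`); Mathlib's `HasFDerivAt.clm_apply`, `HasFDerivAt.smul`,
`ContinuousLinearMap.smulRightL`, `hasFDerivAt_integral_of_dominated_of_fderiv_le`.

WHAT IS PROVED ([folklore]):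
* §1 **`hasFDerivAt_weightedBlockHess`** (the product rule (i));
* §2 `norm_blockTensorDeriv_le`, `norm_weightedThird_le`, `norm_weightedGradTensor_le`, `norm_weightedBlockHess_deriv_le` (`‖Φ‖ ≤ e^{−U}(‖U′‖³ +
  3κ₂‖U′‖ + κ₃)`), `block_third_domination_scalar`, **`block_third_domination_op`** ((ii));
* §3 `aestronglyMeasurable_weightedBlockHess`, `continuous_blockTensorDeriv`, `continuous_weightedBlockHess_deriv`, THE END
  **`hasFDerivAt_block_tiltedHessNumerator`** ((iii));
  §4 toy.

HONEST (what this is NOT).  One dominated differentiation; the third derivative of `W` itself (quotient∕product rules over (402)), its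
continuity and a UNIFORM bound are the next files; no contraction ((β4)), no decaying-covariance polymer expansion ((β3′)); scalar skeleton
((A3), NC-NE7b-α UNRULED); nothing of Bałaban's asserted.  BY-NAME EFFECT ON THE WALL: NONE.  NE7b NOT PRINTED ∕ NOT PROVED; spine PROVED 0∕9;
rung (B)+1 — the programme's measures remain FINITE-torus statements; NOT the mass gap, NOT Clay.  HONEST DEPENDENCY: continuum YM on T⁴ ⇐
BetaPertH ∧ nine spine estimates (0∕9 proved); BetaPertH ⇐ (D1) ∧ (D4) ∧ CAP+tail; G-an2-4 gates asym, D1 and NE2∕3∕4.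
-/

set_option autoImplicit false
set_option maxSynthPendingDepth 3

noncomputable section

namespace Summit.QuantumFields.BalabanUV.T4Continuum.NE7b.SupBlockEffectiveActionThird

open MeasureTheory ProbabilityTheory Finset Real Metric Filter
open scoped BigOperators Topology
open SupEffectiveActionDerivative (integrable_domination mul_opBound_le_of_le)
open SupBlockEffectiveActionDerivative (neg_block_le)
open SupBlockEffectiveActionCovariance (integrable_weightedBlockHess)
open SupBlockStepLineDerivatives (block_third_domination)

variable {ι : Type} [Fintype ι] [DecidableEq ι]

section Pointwise

variable {U : EuclideanSpace ℝ ι → ℝ} {U' : EuclideanSpace ℝ ι → EuclideanSpace ℝ ι →L[ℝ] ℝ}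
  {U'' : EuclideanSpace ℝ ι → EuclideanSpace ℝ ι →L[ℝ] EuclideanSpace ℝ ι →L[ℝ] ℝ}
  {U₃ : EuclideanSpace ℝ ι → EuclideanSpace ℝ ι →L[ℝ] EuclideanSpace ℝ ι →L[ℝ] EuclideanSpace ℝ ι →L[ℝ] ℝ} {κ₀ κ₁ κ₂ κ₃ a τ δ : ℝ}

/-! ## §1. The product rule at the trilinear level -/

omit [DecidableEq ι] in
/-- **THE PRODUCT RULE**: `U ∈ C³` ⟹ at every `ψ, ω`, the weighted Hessian integrand `ψ′ ↦ e^{−U(ω+ψ′)}•(U″(ω+ψ′) − U′(ω+ψ′)⊗U′(ω+ψ′))` has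
derivative `Φ(ω,ψ) = e^{−U}•(U‴ − ((U′⊗·)∘U″ + ((⊗)∘U″)ᵀU′)) + (e^{−U}•(−U′))⊗(U″ − U′⊗U′)` at `ψ`. [folklore] -/
theorem hasFDerivAt_weightedBlockHess (hUd : ∀ φ : EuclideanSpace ℝ ι, HasFDerivAt U (U' φ) φ) (hU'd : ∀ φ : EuclideanSpace ℝ ι, HasFDerivAt U' (U'' φ) φ)
    (hU''d : ∀ φ : EuclideanSpace ℝ ι, HasFDerivAt U'' (U₃ φ) φ) (ω ψ : EuclideanSpace ℝ ι) :
    HasFDerivAt (fun ψ' : EuclideanSpace ℝ ι => exp (-U (ω + ψ')) • (U'' (ω + ψ') - (U' (ω + ψ')).smulRight (U' (ω + ψ'))))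
      (exp (-U (ω + ψ)) • (U₃ (ω + ψ) - (((ContinuousLinearMap.smulRightL ℝ (EuclideanSpace ℝ ι) (EuclideanSpace ℝ ι →L[ℝ] ℝ)) (U' (ω + ψ))).comp (U'' (ω + ψ)) +
          (((ContinuousLinearMap.smulRightL ℝ (EuclideanSpace ℝ ι) (EuclideanSpace ℝ ι →L[ℝ] ℝ))).comp (U'' (ω + ψ))).flip (U' (ω + ψ)))) + (exp (-U (ω + ψ)) • -U' (ω +
          ψ)).smulRight (U'' (ω + ψ) - (U' (ω + ψ)).smulRight (U' (ω + ψ)))) ψ := by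
  have hlin : HasFDerivAt (fun ψ' : EuclideanSpace ℝ ι => ω + ψ') (ContinuousLinearMap.id ℝ (EuclideanSpace ℝ ι)) ψ :=
    (hasFDerivAt_id ψ).const_add ω
  have hU : HasFDerivAt (fun ψ' : EuclideanSpace ℝ ι => U (ω + ψ')) (U' (ω + ψ)) ψ := by
    have h := (hUd (ω + ψ)).comp ψ hlin; rw [ContinuousLinearMap.comp_id] at h; exact h
  have hU1 : HasFDerivAt (fun ψ' : EuclideanSpace ℝ ι => U' (ω + ψ')) (U'' (ω + ψ)) ψ := by
    have h := (hU'd (ω + ψ)).comp ψ hlin; rw [ContinuousLinearMap.comp_id] at h; exact h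
  have hU2 : HasFDerivAt (fun ψ' : EuclideanSpace ℝ ι => U'' (ω + ψ')) (U₃ (ω + ψ)) ψ := by
    have h := (hU''d (ω + ψ)).comp ψ hlin; rw [ContinuousLinearMap.comp_id] at h; exact h
  have hE := hU.fun_neg.exp
  have hC := ((ContinuousLinearMap.smulRightL ℝ (EuclideanSpace ℝ ι) (EuclideanSpace ℝ ι →L[ℝ] ℝ))).hasFDerivAt.comp ψ hU1
  have hT := hC.clm_apply hU1
  exact hE.smul (hU2.sub hT)

/-! ## §2. The third block domination in operator norm -/

omit [DecidableEq ι] in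
/-- The tensor part of the product rule is bounded: `‖(U′⊗·)∘U″ + ((⊗)∘U″)ᵀU′‖ ≤ 2κ₂‖U′‖` (`‖U″‖ ≤ κ₂`, `‖smulRightL‖ ≤ 1`). [folklore] -/
theorem norm_blockTensorDeriv_le (hU''b : ∀ φ : EuclideanSpace ℝ ι, ‖U'' φ‖ ≤ κ₂) (ω ψ : EuclideanSpace ℝ ι) :
    ‖(((ContinuousLinearMap.smulRightL ℝ (EuclideanSpace ℝ ι) (EuclideanSpace ℝ ι →L[ℝ] ℝ)) (U' (ω + ψ))).comp (U'' (ω + ψ)) + (((ContinuousLinearMap.smulRightL ℝ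
        (EuclideanSpace ℝ ι) (EuclideanSpace ℝ ι →L[ℝ] ℝ))).comp (U'' (ω + ψ))).flip (U' (ω + ψ)))‖ ≤ 2 * κ₂ * ‖U' (ω + ψ)‖ := by
  have hn0 : 0 ≤ ‖U' (ω + ψ)‖ := norm_nonneg _
  have hκ₂ : 0 ≤ κ₂ := (norm_nonneg _).trans (hU''b (ω + ψ))
  have hS : ‖(ContinuousLinearMap.smulRightL ℝ (EuclideanSpace ℝ ι) (EuclideanSpace ℝ ι →L[ℝ] ℝ))‖ ≤ 1 := ContinuousLinearMap.norm_smulRightL_le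
  have hSU : ‖(ContinuousLinearMap.smulRightL ℝ (EuclideanSpace ℝ ι) (EuclideanSpace ℝ ι →L[ℝ] ℝ)) (U' (ω + ψ))‖ ≤ ‖U' (ω + ψ)‖ := by
    refine (ContinuousLinearMap.le_opNorm _ _).trans ?_
    calc ‖(ContinuousLinearMap.smulRightL ℝ (EuclideanSpace ℝ ι) (EuclideanSpace ℝ ι →L[ℝ] ℝ))‖ * ‖U' (ω + ψ)‖ ≤ 1 * ‖U' (ω + ψ)‖ := by gcongr
      _ = ‖U' (ω + ψ)‖ := one_mul _
  have hP : ‖((ContinuousLinearMap.smulRightL ℝ (EuclideanSpace ℝ ι) (EuclideanSpace ℝ ι →L[ℝ] ℝ)) (U' (ω + ψ))).comp (U'' (ω + ψ))‖ ≤ ‖U' (ω + ψ)‖ * κ₂ :=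
    (ContinuousLinearMap.opNorm_comp_le _ _).trans (mul_le_mul hSU (hU''b _) (norm_nonneg _) hn0)
  have hSc : ‖((ContinuousLinearMap.smulRightL ℝ (EuclideanSpace ℝ ι) (EuclideanSpace ℝ ι →L[ℝ] ℝ))).comp (U'' (ω + ψ))‖ ≤ κ₂ := by
    refine (ContinuousLinearMap.opNorm_comp_le _ _).trans ?_
    calc ‖(ContinuousLinearMap.smulRightL ℝ (EuclideanSpace ℝ ι) (EuclideanSpace ℝ ι →L[ℝ] ℝ))‖ * ‖U'' (ω + ψ)‖ ≤ 1 * κ₂ := by gcongr; exact hU''b _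
      _ = κ₂ := one_mul κ₂
  have hQ : ‖(((ContinuousLinearMap.smulRightL ℝ (EuclideanSpace ℝ ι) (EuclideanSpace ℝ ι →L[ℝ] ℝ))).comp (U'' (ω + ψ))).flip (U' (ω + ψ))‖ ≤ κ₂ * ‖U' (ω + ψ)‖ := by
    refine (ContinuousLinearMap.le_opNorm _ _).trans ?_
    rw [ContinuousLinearMap.opNorm_flip]
    exact mul_le_mul hSc le_rfl hn0 hκ₂
  refine (norm_add_le _ _).trans ?_
  linarith

omit [DecidableEq ι] in
/-- The weighted third-order term is bounded: `‖e^{−U}•(U‴ − tensor part)‖ ≤ e^{−U}(κ₃ + 2κ₂‖U′‖)`. [folklore] -/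
theorem norm_weightedThird_le (hU''b : ∀ φ : EuclideanSpace ℝ ι, ‖U'' φ‖ ≤ κ₂)
    (hU₃b : ∀ φ : EuclideanSpace ℝ ι, ‖U₃ φ‖ ≤ κ₃) (ω ψ : EuclideanSpace ℝ ι) :
    ‖exp (-U (ω + ψ)) • (U₃ (ω + ψ) - (((ContinuousLinearMap.smulRightL ℝ (EuclideanSpace ℝ ι) (EuclideanSpace ℝ ι →L[ℝ] ℝ)) (U' (ω + ψ))).comp (U'' (ω + ψ)) +
        (((ContinuousLinearMap.smulRightL ℝ (EuclideanSpace ℝ ι) (EuclideanSpace ℝ ι →L[ℝ] ℝ))).comp (U'' (ω + ψ))).flip (U' (ω + ψ))))‖ ≤ exp (-U (ω + ψ)) * (κ₃ + 2 * κ₂ *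
        ‖U' (ω + ψ)‖) := by
  rw [norm_smul, Real.norm_eq_abs, abs_of_pos (exp_pos _)]
  exact mul_le_mul_of_nonneg_left ((norm_sub_le _ _).trans (add_le_add (hU₃b _) (norm_blockTensorDeriv_le hU''b ω ψ))) (exp_pos _).le

omit [DecidableEq ι] in
/-- The weighted gradient-tensor term is bounded: `‖(e^{−U}•(−U′))⊗(U″ − U′⊗U′)‖ ≤ e^{−U}‖U′‖(κ₂ + ‖U′‖²)`. [folklore] -/
theorem norm_weightedGradTensor_le (hU''b : ∀ φ : EuclideanSpace ℝ ι, ‖U'' φ‖ ≤ κ₂) (ω ψ : EuclideanSpace ℝ ι) :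
    ‖(exp (-U (ω + ψ)) • -U' (ω + ψ)).smulRight (U'' (ω + ψ) - (U' (ω + ψ)).smulRight (U' (ω + ψ)))‖ ≤ exp (-U (ω + ψ)) * ‖U' (ω + ψ)‖ * (κ₂ + ‖U' (ω + ψ)‖ ^ 2) := by
  have hR : ‖(U'' (ω + ψ) - (U' (ω + ψ)).smulRight (U' (ω + ψ)))‖ ≤ κ₂ + ‖U' (ω + ψ)‖ ^ 2 := by
    refine (norm_sub_le _ _).trans (add_le_add (hU''b _) ?_)
    rw [ContinuousLinearMap.norm_smulRight_apply, pow_two]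
  rw [ContinuousLinearMap.norm_smulRight_apply, norm_smul, norm_neg, Real.norm_eq_abs, abs_of_pos (exp_pos _)]
  exact mul_le_mul_of_nonneg_left hR (mul_nonneg (exp_pos _).le (norm_nonneg _))

omit [DecidableEq ι] in
/-- `e^{−U}(‖U′‖³ + 3κ₂‖U′‖ + κ₃)` dominates `‖Φ(ω,ψ)‖`. [folklore] -/
theorem norm_weightedBlockHess_deriv_le (hU''b : ∀ φ : EuclideanSpace ℝ ι, ‖U'' φ‖ ≤ κ₂)
    (hU₃b : ∀ φ : EuclideanSpace ℝ ι, ‖U₃ φ‖ ≤ κ₃) (ω ψ : EuclideanSpace ℝ ι) :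
    ‖(exp (-U (ω + ψ)) • (U₃ (ω + ψ) - (((ContinuousLinearMap.smulRightL ℝ (EuclideanSpace ℝ ι) (EuclideanSpace ℝ ι →L[ℝ] ℝ)) (U' (ω + ψ))).comp (U'' (ω + ψ)) +
        (((ContinuousLinearMap.smulRightL ℝ (EuclideanSpace ℝ ι) (EuclideanSpace ℝ ι →L[ℝ] ℝ))).comp (U'' (ω + ψ))).flip (U' (ω + ψ)))) + (exp (-U (ω + ψ)) • -U' (ω +
        ψ)).smulRight (U'' (ω + ψ) - (U' (ω + ψ)).smulRight (U' (ω + ψ))))‖ ≤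
      exp (-U (ω + ψ)) * (‖U' (ω + ψ)‖ ^ 3 + 3 * κ₂ * ‖U' (ω + ψ)‖ + κ₃) :=
  (norm_add_le _ _).trans (((add_le_add (norm_weightedThird_le hU''b hU₃b ω ψ) (norm_weightedGradTensor_le hU''b ω ψ))).trans (le_of_eq (by ring)))

/-- **The third block domination, scalar form**: for `‖ψ − ψ₁‖ ≤ 1` and every `ω`,
`e^{−U(ω+ψ)}(‖U′(ω+ψ)‖³ + 3κ₂‖U′(ω+ψ)‖ + κ₃) ≤ K₃(ψ₁)·e^{½(2κ₀(1+τ)+4δ)Σ_Yω²}` ((405) with a unit vector; the empty lattice apart).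
[folklore] -/
theorem block_third_domination_scalar (Y : Finset ι) (hκ₀ : 0 ≤ κ₀) (hκ₁ : 0 ≤ κ₁) (ha : 0 ≤ a) (hκ₂ : 0 ≤ κ₂) (hκ₃ : 0 ≤ κ₃) (hτ : 0 < τ)
    (hδ : 0 < δ) (hstab : ∀ φ : EuclideanSpace ℝ ι, -(κ₀ * ∑ x ∈ Y, φ x ^ 2) ≤ U φ)
    (hU'b : ∀ φ : EuclideanSpace ℝ ι, ‖U' φ‖ ≤ κ₁ * (a + ∑ x ∈ Y, φ x ^ 2)) (ψ₁ ψ : EuclideanSpace ℝ ι) (hψ : ‖ψ - ψ₁‖ ≤ 1)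
    (ω : EuclideanSpace ℝ ι) :
    exp (-U (ω + ψ)) * (‖U' (ω + ψ)‖ ^ 3 + 3 * κ₂ * ‖U' (ω + ψ)‖ + κ₃) ≤
      (exp (κ₀ * (1 + τ⁻¹) * (2 * ∑ x ∈ Y, ψ₁ x ^ 2 + 2)) * (κ₁ ^ 3 * (4 * (a + 2 * (2 * ∑ x ∈ Y, ψ₁ x ^ 2 + 2)) ^ 3 + 32 * (δ ^ 3)⁻¹) + 3 * κ₂ * κ₁ * ((a + 2 * (2 * ∑ x ∈
          Y, ψ₁ x ^ 2 + 2)) + δ⁻¹) + κ₃)) *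
        exp ((2 * κ₀ * (1 + τ) + 4 * δ) * (∑ x ∈ Y, ω x ^ 2) / 2) := by
  rcases isEmpty_or_nonempty ι with hι | hι
  · -- no sites: `U′ = 0`, `Σ_Y = 0`; the bound is `e^{−U}κ₃ ≤ e^{κ₀(1+τ⁻¹)M}(…+κ₃)·e^{0}`
    have hU'0 : U' (ω + ψ) = 0 := by
      ext v; have : v = 0 := Subsingleton.elim v 0; rw [this, map_zero, map_zero]
    have hY0 : ∀ φ : EuclideanSpace ℝ ι, ∑ x ∈ Y, φ x ^ 2 = 0 := fun φ => Finset.sum_eq_zero fun x _ => (IsEmpty.false x).elim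
    have hV : -U (ω + ψ) ≤ 0 := by have h := hstab (ω + ψ); rw [hY0] at h; linarith
    rw [hU'0, norm_zero, hY0 ω, hY0 ψ₁]
    simp only [mul_zero, zero_div, exp_zero, mul_one, ne_eq, OfNat.ofNat_ne_zero, not_false_eq_true, zero_pow, zero_add, add_zero]
    have hE : exp (-U (ω + ψ)) ≤ 1 := by rw [← exp_zero]; exact exp_le_exp.2 hV
    have hK : κ₃ ≤ exp (κ₀ * (1 + τ⁻¹) * (2 * 0 + 2)) * (κ₁ ^ 3 * (4 * (a + 2 * (2 * 0 + 2)) ^ 3 + 32 * (δ ^ 3)⁻¹) + 3 * κ₂ * κ₁ * ((a + 2 * (2 * 0 + 2)) + δ⁻¹) + κ₃) := by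
      have h1 : 1 ≤ exp (κ₀ * (1 + τ⁻¹) * (2 * 0 + 2)) := one_le_exp (by positivity)
      have h2 : κ₃ ≤ κ₁ ^ 3 * (4 * (a + 2 * (2 * 0 + 2)) ^ 3 + 32 * (δ ^ 3)⁻¹) + 3 * κ₂ * κ₁ * ((a + 2 * (2 * 0 + 2)) + δ⁻¹) + κ₃ := by
        have : 0 ≤ κ₁ ^ 3 * (4 * (a + 2 * (2 * 0 + 2)) ^ 3 + 32 * (δ ^ 3)⁻¹) + 3 * κ₂ * κ₁ * ((a + 2 * (2 * 0 + 2)) + δ⁻¹) := by positivity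
        linarith
      nlinarith
    nlinarith
  · obtain ⟨i⟩ := hι
    have hh : ‖(EuclideanSpace.single i (1 : ℝ) : EuclideanSpace ℝ ι)‖ = 1 := by simp
    have h := block_third_domination Y hκ₀ hκ₁ ha hκ₂ hκ₃ hτ hδ hstab hU'b ψ₁ ψ hψ ω (EuclideanSpace.single i (1 : ℝ))
    rw [hh, one_pow, one_mul, one_mul] at h
    exact h

/-- **THE THIRD BLOCK DOMINATION IN OPERATOR NORM**: for `‖ψ − ψ₁‖ ≤ 1` and every `ω`, `‖Φ(ω,ψ)‖ ≤ K₃(ψ₁)·e^{½(2κ₀(1+τ)+4δ)Σ_Yω²}`. [folklore] -/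
theorem block_third_domination_op (Y : Finset ι) (hκ₀ : 0 ≤ κ₀) (hκ₁ : 0 ≤ κ₁) (ha : 0 ≤ a) (hκ₂ : 0 ≤ κ₂) (hκ₃ : 0 ≤ κ₃) (hτ : 0 < τ)
    (hδ : 0 < δ) (hstab : ∀ φ : EuclideanSpace ℝ ι, -(κ₀ * ∑ x ∈ Y, φ x ^ 2) ≤ U φ)
    (hU'b : ∀ φ : EuclideanSpace ℝ ι, ‖U' φ‖ ≤ κ₁ * (a + ∑ x ∈ Y, φ x ^ 2)) (hU''b : ∀ φ : EuclideanSpace ℝ ι, ‖U'' φ‖ ≤ κ₂)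
    (hU₃b : ∀ φ : EuclideanSpace ℝ ι, ‖U₃ φ‖ ≤ κ₃) (ψ₁ ψ : EuclideanSpace ℝ ι) (hψ : ‖ψ - ψ₁‖ ≤ 1) (ω : EuclideanSpace ℝ ι) :
    ‖(exp (-U (ω + ψ)) • (U₃ (ω + ψ) - (((ContinuousLinearMap.smulRightL ℝ (EuclideanSpace ℝ ι) (EuclideanSpace ℝ ι →L[ℝ] ℝ)) (U' (ω + ψ))).comp (U'' (ω + ψ)) +
        (((ContinuousLinearMap.smulRightL ℝ (EuclideanSpace ℝ ι) (EuclideanSpace ℝ ι →L[ℝ] ℝ))).comp (U'' (ω + ψ))).flip (U' (ω + ψ)))) + (exp (-U (ω + ψ)) • -U' (ω +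
        ψ)).smulRight (U'' (ω + ψ) - (U' (ω + ψ)).smulRight (U' (ω + ψ))))‖ ≤
      (exp (κ₀ * (1 + τ⁻¹) * (2 * ∑ x ∈ Y, ψ₁ x ^ 2 + 2)) * (κ₁ ^ 3 * (4 * (a + 2 * (2 * ∑ x ∈ Y, ψ₁ x ^ 2 + 2)) ^ 3 + 32 * (δ ^ 3)⁻¹) + 3 * κ₂ * κ₁ * ((a + 2 * (2 * ∑ x ∈
          Y, ψ₁ x ^ 2 + 2)) + δ⁻¹) + κ₃)) *
        exp ((2 * κ₀ * (1 + τ) + 4 * δ) * (∑ x ∈ Y, ω x ^ 2) / 2) :=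
  (norm_weightedBlockHess_deriv_le hU''b hU₃b ω ψ).trans (block_third_domination_scalar Y hκ₀ hκ₁ ha hκ₂ hκ₃ hτ hδ hstab hU'b ψ₁ ψ hψ ω)

end Pointwise

/-! ## §3. THE END: dominated differentiation of the tilted Hessian numerator -/

section TheEnd

variable {Γ : Matrix ι ι ℝ} {γop : ℝ} {U : EuclideanSpace ℝ ι → ℝ} {U' : EuclideanSpace ℝ ι → EuclideanSpace ℝ ι →L[ℝ] ℝ}
  {U'' : EuclideanSpace ℝ ι → EuclideanSpace ℝ ι →L[ℝ] EuclideanSpace ℝ ι →L[ℝ] ℝ}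
  {U₃ : EuclideanSpace ℝ ι → EuclideanSpace ℝ ι →L[ℝ] EuclideanSpace ℝ ι →L[ℝ] EuclideanSpace ℝ ι →L[ℝ] ℝ} {κ₀ κ₁ κ₂ κ₃ a τ δ θ : ℝ}

omit [DecidableEq ι] in
/-- The weighted Hessian integrand is a.e.-strongly measurable at every background (continuity). [folklore] -/
theorem aestronglyMeasurable_weightedBlockHess (μ : Measure (EuclideanSpace ℝ ι)) (hUd : ∀ φ : EuclideanSpace ℝ ι, HasFDerivAt U (U' φ) φ)
    (hU'd : ∀ φ : EuclideanSpace ℝ ι, HasFDerivAt U' (U'' φ) φ) (hU''c : Continuous U'') (ψ : EuclideanSpace ℝ ι) :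
    AEStronglyMeasurable (fun ω : EuclideanSpace ℝ ι => exp (-U (ω + ψ)) • (U'' (ω + ψ) - (U' (ω + ψ)).smulRight (U' (ω + ψ)))) μ := by
  have hU'c : Continuous U' := continuous_iff_continuousAt.2 fun φ => (hU'd φ).continuousAt
  have hUc : Continuous U := continuous_iff_continuousAt.2 fun φ => (hUd φ).continuousAt
  refine ((continuous_exp.comp (hUc.comp (continuous_id.add continuous_const)).neg).aestronglyMeasurable).smul ?_
  refine ((hU''c.comp (continuous_id.add continuous_const)).aestronglyMeasurable).sub ?_
  have hD : AEStronglyMeasurable (fun ω : EuclideanSpace ℝ ι => U' (ω + ψ)) μ := (hU'c.comp (continuous_id.add continuous_const)).aestronglyMeasurable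
  exact isBoundedBilinearMap_smulRight.continuous.comp_aestronglyMeasurable (hD.prodMk hD)
set_option maxHeartbeats 400000 in
omit [DecidableEq ι] in
/-- The tensor part `ω ↦ (U′⊗·)∘U″ + ((⊗)∘U″)ᵀU′` (at `ω+ψ`) is continuous. [folklore] -/
theorem continuous_blockTensorDeriv (hU'd : ∀ φ : EuclideanSpace ℝ ι, HasFDerivAt U' (U'' φ) φ) (hU''c : Continuous U'') (ψ : EuclideanSpace ℝ ι) :
    Continuous fun ω : EuclideanSpace ℝ ι => (((ContinuousLinearMap.smulRightL ℝ (EuclideanSpace ℝ ι) (EuclideanSpace ℝ ι →L[ℝ] ℝ)) (U' (ω + ψ))).comp (U'' (ω + ψ)) +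
        (((ContinuousLinearMap.smulRightL ℝ (EuclideanSpace ℝ ι) (EuclideanSpace ℝ ι →L[ℝ] ℝ))).comp (U'' (ω + ψ))).flip (U' (ω + ψ))) := by
  have hU'c : Continuous U' := continuous_iff_continuousAt.2 fun φ => (hU'd φ).continuousAt
  have hsh : Continuous fun ω : EuclideanSpace ℝ ι => ω + ψ := continuous_id.add continuous_const
  have hD : Continuous fun ω : EuclideanSpace ℝ ι => U' (ω + ψ) := hU'c.comp hsh
  have hH : Continuous fun ω : EuclideanSpace ℝ ι => U'' (ω + ψ) := hU''c.comp hsh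
  have hS : Continuous fun ω : EuclideanSpace ℝ ι => (ContinuousLinearMap.smulRightL ℝ (EuclideanSpace ℝ ι) (EuclideanSpace ℝ ι →L[ℝ] ℝ)) (U' (ω + ψ)) :=
      ((ContinuousLinearMap.smulRightL ℝ (EuclideanSpace ℝ ι) (EuclideanSpace ℝ ι →L[ℝ] ℝ))).continuous.comp hD
  have hP : Continuous fun ω : EuclideanSpace ℝ ι => ((ContinuousLinearMap.smulRightL ℝ (EuclideanSpace ℝ ι) (EuclideanSpace ℝ ι →L[ℝ] ℝ)) (U' (ω + ψ))).comp (U'' (ω + ψ))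
      :=
    (isBoundedBilinearMap_comp (𝕜 := ℝ) (E := EuclideanSpace ℝ ι) (F := EuclideanSpace ℝ ι →L[ℝ] ℝ)
      (G := EuclideanSpace ℝ ι →L[ℝ] EuclideanSpace ℝ ι →L[ℝ] ℝ)).continuous.comp (hS.prodMk hH)
  have hSc : Continuous fun ω : EuclideanSpace ℝ ι => ((ContinuousLinearMap.smulRightL ℝ (EuclideanSpace ℝ ι) (EuclideanSpace ℝ ι →L[ℝ] ℝ))).comp (U'' (ω + ψ)) :=
    (isBoundedBilinearMap_comp (𝕜 := ℝ) (E := EuclideanSpace ℝ ι) (F := EuclideanSpace ℝ ι →L[ℝ] ℝ)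
      (G := (EuclideanSpace ℝ ι →L[ℝ] ℝ) →L[ℝ] EuclideanSpace ℝ ι →L[ℝ] EuclideanSpace ℝ ι →L[ℝ] ℝ)).continuous.comp (continuous_const.prodMk hH)
  have hfl : Continuous fun ω : EuclideanSpace ℝ ι => (((ContinuousLinearMap.smulRightL ℝ (EuclideanSpace ℝ ι) (EuclideanSpace ℝ ι →L[ℝ] ℝ))).comp (U'' (ω + ψ))).flip :=
    (ContinuousLinearMap.flipₗᵢ ℝ (EuclideanSpace ℝ ι) (EuclideanSpace ℝ ι →L[ℝ] ℝ) (EuclideanSpace ℝ ι →L[ℝ] EuclideanSpace ℝ ι →L[ℝ] ℝ)).continuous.comp hSc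
  have hQ : Continuous fun ω : EuclideanSpace ℝ ι => (((ContinuousLinearMap.smulRightL ℝ (EuclideanSpace ℝ ι) (EuclideanSpace ℝ ι →L[ℝ] ℝ))).comp (U'' (ω + ψ))).flip (U' (ω
      + ψ)) :=
    (isBoundedBilinearMap_apply (𝕜 := ℝ) (E := EuclideanSpace ℝ ι →L[ℝ] ℝ) (F := EuclideanSpace ℝ ι →L[ℝ] EuclideanSpace ℝ ι →L[ℝ] EuclideanSpace ℝ ι →L[ℝ]
        ℝ)).continuous.comp
      (hfl.prodMk hD)
  exact hP.add hQ

omit [DecidableEq ι] in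
/-- The derivative integrand `ω ↦ Φ(ω,ψ)` is continuous (hence a.e.-strongly measurable). [folklore] -/
theorem continuous_weightedBlockHess_deriv (hUd : ∀ φ : EuclideanSpace ℝ ι, HasFDerivAt U (U' φ) φ) (hU'd : ∀ φ : EuclideanSpace ℝ ι, HasFDerivAt U' (U'' φ) φ)
    (hU''d : ∀ φ : EuclideanSpace ℝ ι, HasFDerivAt U'' (U₃ φ) φ) (hU₃c : Continuous U₃) (ψ : EuclideanSpace ℝ ι) :
    Continuous fun ω : EuclideanSpace ℝ ι => (exp (-U (ω + ψ)) • (U₃ (ω + ψ) - (((ContinuousLinearMap.smulRightL ℝ (EuclideanSpace ℝ ι) (EuclideanSpace ℝ ι →L[ℝ] ℝ)) (U' (ω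
        + ψ))).comp (U'' (ω + ψ)) + (((ContinuousLinearMap.smulRightL ℝ (EuclideanSpace ℝ ι) (EuclideanSpace ℝ ι →L[ℝ] ℝ))).comp (U'' (ω + ψ))).flip (U' (ω + ψ)))) + (exp
        (-U (ω + ψ)) • -U' (ω + ψ)).smulRight (U'' (ω + ψ) - (U' (ω + ψ)).smulRight (U' (ω + ψ)))) := by
  have hU''c : Continuous U'' := continuous_iff_continuousAt.2 fun φ => (hU''d φ).continuousAt
  have hU'c : Continuous U' := continuous_iff_continuousAt.2 fun φ => (hU'd φ).continuousAt
  have hUc : Continuous U := continuous_iff_continuousAt.2 fun φ => (hUd φ).continuousAt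
  have hsh : Continuous fun ω : EuclideanSpace ℝ ι => ω + ψ := continuous_id.add continuous_const
  have hE : Continuous fun ω : EuclideanSpace ℝ ι => exp (-U (ω + ψ)) := continuous_exp.comp ((hUc.comp hsh).neg)
  have hD : Continuous fun ω : EuclideanSpace ℝ ι => U' (ω + ψ) := hU'c.comp hsh
  have hH : Continuous fun ω : EuclideanSpace ℝ ι => U'' (ω + ψ) := hU''c.comp hsh
  have h3 : Continuous fun ω : EuclideanSpace ℝ ι => U₃ (ω + ψ) := hU₃c.comp hsh
  have hR : Continuous fun ω : EuclideanSpace ℝ ι => (U'' (ω + ψ) - (U' (ω + ψ)).smulRight (U' (ω + ψ))) :=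
    hH.sub ((isBoundedBilinearMap_smulRight (𝕜 := ℝ) (E := EuclideanSpace ℝ ι) (F := EuclideanSpace ℝ ι →L[ℝ] ℝ)).continuous.comp (hD.prodMk hD))
  have h1 : Continuous fun ω : EuclideanSpace ℝ ι => exp (-U (ω + ψ)) • (U₃ (ω + ψ) - (((ContinuousLinearMap.smulRightL ℝ (EuclideanSpace ℝ ι) (EuclideanSpace ℝ ι →L[ℝ] ℝ))
      (U' (ω + ψ))).comp (U'' (ω + ψ)) + (((ContinuousLinearMap.smulRightL ℝ (EuclideanSpace ℝ ι) (EuclideanSpace ℝ ι →L[ℝ] ℝ))).comp (U'' (ω + ψ))).flip (U' (ω + ψ)))) :=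
    hE.smul (h3.sub (continuous_blockTensorDeriv hU'd hU''c ψ))
  have h2 : Continuous fun ω : EuclideanSpace ℝ ι => (exp (-U (ω + ψ)) • -U' (ω + ψ)).smulRight (U'' (ω + ψ) - (U' (ω + ψ)).smulRight (U' (ω + ψ))) :=
    (isBoundedBilinearMap_smulRight (𝕜 := ℝ) (E := EuclideanSpace ℝ ι) (F := EuclideanSpace ℝ ι →L[ℝ] EuclideanSpace ℝ ι →L[ℝ] ℝ)).continuous.comp
      ((hE.smul hD.neg).prodMk hR)
  exact h1.add h2

/-- **THE END — THE TILTED HESSIAN NUMERATOR IS DIFFERENTIABLE AT EVERY BACKGROUND.**  `Γ ⪰ 0`, `Γ ⪯ γ_op·1`; `U ∈ C³` with the four block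
letters; `0 < τ, δ`, `θ < 1`, `(2κ₀(1+τ)+4δ)γ_op ≤ θ` ⟹ at EVERY `ψ₀`,
`HasFDerivAt (ψ ↦ ∫e^{−U(ω+ψ)}•(U″(ω+ψ) − U′(ω+ψ)⊗U′(ω+ψ))dN(0,Γ)) (∫Φ(ω,ψ₀)dN(0,Γ)) ψ₀`. [folklore] -/
theorem hasFDerivAt_block_tiltedHessNumerator (hΓ : Γ.PosSemidef) (hΓop : (γop • (1 : Matrix ι ι ℝ) - Γ).PosSemidef) (Y : Finset ι)
    (hUd : ∀ φ : EuclideanSpace ℝ ι, HasFDerivAt U (U' φ) φ) (hU'd : ∀ φ : EuclideanSpace ℝ ι, HasFDerivAt U' (U'' φ) φ)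
    (hU''d : ∀ φ : EuclideanSpace ℝ ι, HasFDerivAt U'' (U₃ φ) φ) (hU₃c : Continuous U₃) (hκ₀ : 0 ≤ κ₀) (hκ₁ : 0 ≤ κ₁) (ha : 0 ≤ a) (hκ₂ : 0 ≤ κ₂) (hκ₃ : 0 ≤ κ₃) (hτ : 0 <
        τ) (hδ : 0 < δ)
    (hθ1 : θ < 1) (hκθ : (2 * κ₀ * (1 + τ) + 4 * δ) * γop ≤ θ) (hstab : ∀ φ : EuclideanSpace ℝ ι, -(κ₀ * ∑ x ∈ Y, φ x ^ 2) ≤ U φ)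
    (hU'b : ∀ φ : EuclideanSpace ℝ ι, ‖U' φ‖ ≤ κ₁ * (a + ∑ x ∈ Y, φ x ^ 2)) (hU''b : ∀ φ : EuclideanSpace ℝ ι, ‖U'' φ‖ ≤ κ₂)
    (hU₃b : ∀ φ : EuclideanSpace ℝ ι, ‖U₃ φ‖ ≤ κ₃) (ψ₀ : EuclideanSpace ℝ ι) :
    HasFDerivAt (fun ψ : EuclideanSpace ℝ ι => (∫ ω : EuclideanSpace ℝ ι, exp (-U (ω + ψ)) • (U'' (ω + ψ) - (U' (ω + ψ)).smulRight (U' (ω + ψ))) ∂(multivariateGaussian 0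
        Γ)))
      (∫ ω : EuclideanSpace ℝ ι, (exp (-U (ω + ψ₀)) • (U₃ (ω + ψ₀) - (((ContinuousLinearMap.smulRightL ℝ (EuclideanSpace ℝ ι) (EuclideanSpace ℝ ι →L[ℝ] ℝ)) (U' (ω +
          ψ₀))).comp (U'' (ω + ψ₀)) + (((ContinuousLinearMap.smulRightL ℝ (EuclideanSpace ℝ ι) (EuclideanSpace ℝ ι →L[ℝ] ℝ))).comp (U'' (ω + ψ₀))).flip (U' (ω + ψ₀)))) +
          (exp (-U (ω + ψ₀)) • -U' (ω + ψ₀)).smulRight (U'' (ω + ψ₀) - (U' (ω + ψ₀)).smulRight (U' (ω + ψ₀)))) ∂(multivariateGaussian 0 Γ)) ψ₀ := by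
  have hU''c : Continuous U'' := continuous_iff_continuousAt.2 fun φ => (hU''d φ).continuousAt
  exact hasFDerivAt_integral_of_dominated_of_fderiv_le (μ := (multivariateGaussian 0 Γ)) (x₀ := ψ₀) (s := closedBall ψ₀ 1)
    (closedBall_mem_nhds ψ₀ one_pos) (Eventually.of_forall fun ψ => aestronglyMeasurable_weightedBlockHess _ hUd hU'd hU''c ψ)
    (integrable_weightedBlockHess hΓ hΓop Y hUd hU'd hU''c hκ₀ hκ₁ ha hκ₂ hτ hδ hθ1 hκθ hstab hU'b hU''b ψ₀)
    ((continuous_weightedBlockHess_deriv hUd hU'd hU''d hU₃c ψ₀).aestronglyMeasurable)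
    (Eventually.of_forall fun ω ψ hψ => by
      rw [mem_closedBall, dist_eq_norm] at hψ
      exact block_third_domination_op Y hκ₀ hκ₁ ha hκ₂ hκ₃ hτ hδ hstab hU'b hU''b hU₃b ψ₀ ψ hψ ω)
    (integrable_domination hΓ hΓop Y hκ₀ hτ hδ hθ1 hκθ (exp (κ₀ * (1 + τ⁻¹) * (2 * ∑ x ∈ Y, ψ₀ x ^ 2 + 2)) * (κ₁ ^ 3 * (4 * (a + 2 * (2 * ∑ x ∈ Y, ψ₀ x ^ 2 + 2)) ^ 3 + 32 *
        (δ ^ 3)⁻¹) + 3 * κ₂ * κ₁ * ((a + 2 * (2 * ∑ x ∈ Y, ψ₀ x ^ 2 + 2)) + δ⁻¹) + κ₃)))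
    (Eventually.of_forall fun ω ψ _ => hasFDerivAt_weightedBlockHess hUd hU'd hU''d ω ψ)

end TheEnd

/-! ## §4. Toy -/

/-- Toy (§2): the operator norm of `smulRightL` is at most one, the only property of `⊗` the domination uses. -/
example : ‖(ContinuousLinearMap.smulRightL ℝ (EuclideanSpace ℝ ι) (EuclideanSpace ℝ ι →L[ℝ] ℝ))‖ ≤ 1 := ContinuousLinearMap.norm_smulRightL_le

end Summit.QuantumFields.BalabanUV.T4Continuum.NE7b.SupBlockEffectiveActionThird
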